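import Summits.RiemannHypothesis.RiemannHypothesis.Theorems.GapsEvoDoorsFFSpacingCriterion
import Summits.RiemannHypothesis.RiemannHypothesis.Theorems.GapsEvoDoorsSpacingToCI
import Summits.RiemannHypothesis.RiemannHypothesis.Theorems.GapsEvoDoorsSincCertificate
import Summits.RiemannHypothesis.RiemannHypothesis.Theorems.GapsEvoDoorsW2Witness

/-!
# GapsEvoDoors — `FragmentToCI` at the explicit windows `Δ = 2` and `Δ = 3/2`

Window corollaries of the crux `FragmentToCI` (item stmt-RiemannHypothesis-22418, closed by
`GapsEvoDoorsWindow.FragmentToCI_holds` with the floor window `Δ = 100`), filed as helpers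
(`--supports`) of that closed item. They move the KERNEL WINDOW OF RECORD from `100` down to the
cell's certified cells, using the two kernel witnesses of `DeltaCIFinite` that are now tree theorems:

* `fragmentToCI_of_certificate` — the glue, once: a `DeltaCIFinite`-type witness `r` at
  `(Δ, ε, λ)`, `λ < 1/2`, turns the two-sided fragment «`|F(α, T) − 1| ≤ ε` on `1 < |α| ≤ Δ` for all
  large `T`», RH and one close pair below height `2001` into Conrey–Iwaniec's (1.22),
  `∃ c > 0, SubnormalGapsHypothesis c` — `GapsEvoDoorsWindow.FFSpacingCriterionAll_holds`
  (item 22422) followed by `GapsEvoDoorsSpacingToCI.SpacingToCI_holds` (item 22423), exactly the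
  shape of `FragmentToCI_holds` with the floor criterion replaced by the two-sided one;
* `fragmentToCI_window_two` — window `Δ = 2`, tolerance `ε = 1/100`, on eng-1's sinc witness
  `GapsEvoDoorsSinc.witness` (`λ = 49/100`, certificate `139/1200 − (101/100)μ > 0`, referee V-23);
* `fragmentToCI_window_threeHalves` — window `Δ = 3/2`, tolerance `ε = 1/20`, on the W₂-EXACT
  record cell `GapsEvoDoorsW2.DeltaCIFinite_recordCell` (`λ = 99/200`, `c ∈ [0.0081449, 0.0081451]`);
* `fragmentToCI_at_threeHalves` — hence the crux's own `∀ ε`-fragment hypothesis already suffices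
  on the window `Δ = 3/2` (take `ε = 1/20`).

All statements are RH-CONDITIONAL and conditional on a pair-correlation FRAGMENT beyond the
diagonal; they are rungs about zero spacings inside route GapsEvoDoors (door (a), Δ_CI records),
never claims toward RH — «toward RiemannHypothesis: 0». Nothing here bears on the truth of RH.
-/

noncomputable section

open Filter Set MeasureTheory Real

set_option linter.dupNamespace false  -- the mandated namespace repeats `RiemannHypothesis`

namespace Summit.RiemannHypothesis.RiemannHypothesis.Theorems.GapsEvoDoorsWindow

open Literature.NumberTheory.LFunctions Literature.NumberTheory.LFunctions.BGMM2023

/-- **Glue**: a `DeltaCIFinite`-type witness `r` at `(Δ, ε, λ)` with `0 < λ < 1/2` (even, continuous,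
integrable, `r̂ ∈ L¹`, `r ≤ 1`, `r ≤ 0` off `[−λ, λ]`, `r̂ ≥ 0` for `|α| ≥ Δ`, positive two-sided
certificate `c(r; Δ, ε) > 0`) turns the fragment `|F − 1| ≤ ε` on `1 < |α| ≤ Δ` (all large `T`),
RH and one close pair of critical zeros below height `2001` into `∃ c > 0, SubnormalGapsHypothesis c`:
`FFSpacingCriterionAll_holds` gives `SpacingDensityPos λ`, then `SpacingToCI_holds`. -/
theorem fragmentToCI_of_certificate {Δ ε lam : ℝ} {r : ℝ → ℝ} (hΔ : 1 ≤ Δ) (hε : 0 ≤ ε)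
    (h0 : 0 < lam) (h1 : lam < 1 / 2) (hev : ∀ u : ℝ, r (-u) = r u) (hco : Continuous r)
    (hin : Integrable r) (hti : Integrable (cosTransform r)) (hle : ∀ u : ℝ, r u ≤ 1)
    (hno : ∀ u : ℝ, lam < |u| → r u ≤ 0) (htail : ∀ α : ℝ, Δ ≤ |α| → 0 ≤ cosTransform r α)
    (hc : 0 < cosTransform r 0 - 1 + 2 * (∫ α in (0 : ℝ)..1, α * cosTransform r α) +
      2 * (∫ α in (1 : ℝ)..Δ, ((1 - ε) * max (cosTransform r α) 0 -
        (1 + ε) * max (-cosTransform r α) 0)))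
    (hFF : ∃ T₀ : ℝ, ∀ T : ℝ, T₀ ≤ T → ∀ α : ℝ, 1 < |α| → |α| ≤ Δ →
      |montgomeryFormFactor α T - 1| ≤ ε)
    (hRH : _root_.RiemannHypothesis) (h₀ : (closeCriticalZeros 2001).Nonempty) :
    ∃ c : ℝ, 0 < c ∧ SubnormalGapsHypothesis c := by
  have hcrit := FFSpacingCriterionAll_holds
  unfold Summit.RiemannHypothesis.RiemannHypothesis.Theses.GapsEvoDoors.FFSpacingCriterionAll
    at hcrit
  have hSD : SpacingDensityPos lam :=
    hcrit Δ ε hΔ hε hFF hRH lam r h0 hev hco hin hti hle hno htail hc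
  have hb := GapsEvoDoorsSpacingToCI.SpacingToCI_holds
  unfold Summit.RiemannHypothesis.RiemannHypothesis.Theses.GapsEvoDoors.SpacingToCI at hb
  exact hb hRH lam h0.le h1 hSD h₀

/-- **`FragmentToCI` on the window `Δ = 2` with tolerance `1/100`**: if `|F(α, T) − 1| ≤ 1/100` on
`1 < |α| ≤ 2` for all large `T`, then RH and one close pair of critical zeros below height `2001`
give `∃ c > 0, SubnormalGapsHypothesis c` (Conrey–Iwaniec (1.22)). Witness: eng-1's sinc object
`GapsEvoDoorsSinc.witness`, `r(u) = (1 − u²/λ²)·sinc(πu)⁴`, `λ = 49/100` (referee V-23). -/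
theorem fragmentToCI_window_two
    (hFF : ∃ T₀ : ℝ, ∀ T : ℝ, T₀ ≤ T → ∀ α : ℝ, 1 < |α| → |α| ≤ 2 →
      |montgomeryFormFactor α T - 1| ≤ 1 / 100)
    (hRH : _root_.RiemannHypothesis) (h₀ : (closeCriticalZeros 2001).Nonempty) :
    ∃ c : ℝ, 0 < c ∧ SubnormalGapsHypothesis c :=
  fragmentToCI_of_certificate (r := GapsEvoDoorsSinc.witness) (by norm_num) (by norm_num)
    GapsEvoDoorsSinc.lam_bounds.1 GapsEvoDoorsSinc.lam_bounds.2 GapsEvoDoorsSinc.witness_neg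
    GapsEvoDoorsSinc.witness_continuous GapsEvoDoorsSinc.witness_integrable
    GapsEvoDoorsSinc.sinc_witness_transform_integrable GapsEvoDoorsSinc.witness_le_one
    (fun _ hu ↦ GapsEvoDoorsSinc.witness_nonpos hu)
    (fun _ ha ↦ GapsEvoDoorsSinc.sinc_witness_transform_nonneg ha)
    GapsEvoDoorsSinc.sinc_witness_certificate_pos hFF hRH h₀

/-- **`FragmentToCI` on the window `Δ = 3/2` with tolerance `1/20`**: if `|F(α, T) − 1| ≤ 1/20` on
`1 < |α| ≤ 3/2` for all large `T`, then RH and one close pair of critical zeros below height `2001`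
give `∃ c > 0, SubnormalGapsHypothesis c`. Witness: the W₂-EXACT record cell
`GapsEvoDoorsW2.DeltaCIFinite_recordCell` at `(Δ, ε, λ) = (3/2, 1/20, 99/200)` (its `r̂ ≥ 0`
everywhere, certificate `c ∈ [0.0081449, 0.0081451]`, eng-2 / referee V-11). -/
theorem fragmentToCI_window_threeHalves
    (hFF : ∃ T₀ : ℝ, ∀ T : ℝ, T₀ ≤ T → ∀ α : ℝ, 1 < |α| → |α| ≤ 3 / 2 →
      |montgomeryFormFactor α T - 1| ≤ 1 / 20)
    (hRH : _root_.RiemannHypothesis) (h₀ : (closeCriticalZeros 2001).Nonempty) :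
    ∃ c : ℝ, 0 < c ∧ SubnormalGapsHypothesis c := by
  obtain ⟨r, hev, hco, hin, hti, hle, hno, htail, hc⟩ := GapsEvoDoorsW2.DeltaCIFinite_recordCell
  exact fragmentToCI_of_certificate (by norm_num) (by norm_num) (by norm_num) (by norm_num) hev hco
    hin hti hle hno (fun α _ ↦ htail α) hc hFF hRH h₀

/-- **The crux's hypothesis already suffices on the window `Δ = 3/2`**: the `∀ ε`-fragment
«`F(α, T) → 1` uniformly on `1 < |α| ≤ 3/2`» (the inner statement of `Theses.GapsEvoDoors.FragmentToCI`
at the witness `Δ = 3/2`), RH and one close pair below `2001` give `∃ c > 0, SubnormalGapsHypothesis c`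
— specialise to `ε = 1/20` and apply `fragmentToCI_window_threeHalves`. -/
theorem fragmentToCI_at_threeHalves
    (hFF : ∀ ε : ℝ, 0 < ε → ∃ T₀ : ℝ, ∀ T : ℝ, T₀ ≤ T → ∀ α : ℝ, 1 < |α| → |α| ≤ 3 / 2 →
      |montgomeryFormFactor α T - 1| ≤ ε)
    (hRH : _root_.RiemannHypothesis) (h₀ : (closeCriticalZeros 2001).Nonempty) :
    ∃ c : ℝ, 0 < c ∧ SubnormalGapsHypothesis c :=
  fragmentToCI_window_threeHalves (hFF (1 / 20) (by norm_num)) hRH h₀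

end Summit.RiemannHypothesis.RiemannHypothesis.Theorems.GapsEvoDoorsWindow

end
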